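import Mathlib
import Literature.MathematicalPhysics.MHD.CerfonFreidbergSolutions
import HarnessLib

/-!
# Second-order contact of a level set `U = 0` with the Cerfon–Freidberg reference surface (6.154): the
# equatorial curvature constraints of (6.155) ARE `U_YY = −[d²X/dY²]·U_X` (proved by the chain rule) — the
# kernel form of «geometry decides» in the `N₁, N₂` ERRATUM of `CerfonFreidbergSolutions.lean`

For a `C²`-type flux function `U` (Fréchet-differentiable everywhere with derivative field `Du`, itself
differentiable at the point) and the reference curve `γ(τ) = (X(τ), Y(τ))` of (6.154), the second
`τ`-derivative of `U ∘ γ` at the outer equatorial point `τ = 0` is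
`(εκ)²·U_YY(1+ε, 0) − ε(1+δ₀)²·U_X(1+ε, 0)` (chain rule: `D²U(γ′, γ′) + DU(γ″)` with `γ′(0) = (0, εκ)`,
`γ″(0) = (−ε(1+δ₀)², 0)`), and at the inner point `τ = π` it is
`(εκ)²·U_YY(1−ε, 0) + ε(1−δ₀)²·U_X(1−ε, 0)`.  Hence «`U ∘ γ` is flat to second order» (`(U∘γ)″ = 0`; the
first order is automatic once `U_Y = 0` on the midplane) is EQUIVALENT to `U_YY = +((1+δ₀)²/(εκ²))·U_X`
resp. `U_YY = −((1−δ₀)²/(εκ²))·U_X`, i.e. to `U_YY = N1·U_X`, `U_YY = N2·U_X` with the typed closed forms —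
the constraints of `IsBoundaryFitGeom`, NOT of `IsBoundaryFit` (which has `−N1`, `−N2`).  This is the
kernel statement behind the ERRATUM section of `CerfonFreidbergSolutions.lean` (there: the bracket values
`[d²X/dY²]` proved; here: why the constraint is `U_YY = −[d²X/dY²]U_X`).  Partial derivatives are the tree's
`GradShafranov.dR/dZZ` (one-variable `deriv`s), identified with `Du`, `D2` by the chain rule along
coordinate lines. HONEST FRAMING: pure calculus about the printed curve and constraints; no equilibrium,
no stability content. Typer/prover: gridfusion-model-5 (g4), 2026-08-27.
-/

noncomputable section

namespace Literature.MathematicalPhysics.MHD.CerfonFreidberg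

open GradShafranov _root_.Real Function

section chain

variable {U : ℝ → ℝ → ℝ} {Du : ℝ × ℝ → (ℝ × ℝ →L[ℝ] ℝ)}

/-- `U_R(R, Z) = DU(R,Z)·(1, 0)` for an everywhere Fréchet-differentiable `U`. [folklore] -/
private theorem dR_eq_fderiv_apply (hU : ∀ p, HasFDerivAt (uncurry U) (Du p) p) (R Z : ℝ) :
    dR U R Z = Du (R, Z) (1, 0) := by
  have hc : HasDerivAt (fun r : ℝ => (r, Z)) ((1 : ℝ), (0 : ℝ)) R :=
    (hasDerivAt_id' R).prodMk (hasDerivAt_const R Z)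
  have h := (hU (R, Z)).comp_hasDerivAt R hc
  simp only [Function.comp_def, Function.uncurry_apply_pair] at h
  exact h.deriv

/-- `U_Z(R, Z) = DU(R,Z)·(0, 1)`. [folklore] -/
private theorem dZ_eq_fderiv_apply (hU : ∀ p, HasFDerivAt (uncurry U) (Du p) p) (R Z : ℝ) :
    dZ U R Z = Du (R, Z) (0, 1) := by
  have hc : HasDerivAt (fun z : ℝ => (R, z)) ((0 : ℝ), (1 : ℝ)) Z :=
    (hasDerivAt_const Z R).prodMk (hasDerivAt_id' Z)
  have h := (hU (R, Z)).comp_hasDerivAt Z hc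
  simp only [Function.comp_def, Function.uncurry_apply_pair] at h
  exact h.deriv

/-- `U_ZZ(R, Z) = D²U(R,Z)·((0,1),(0,1))` when, in addition, `DU` is differentiable at `(R, Z)` with
derivative `D2`. [folklore] -/
private theorem dZZ_eq_fderiv2_apply (hU : ∀ p, HasFDerivAt (uncurry U) (Du p) p)
    {D2 : ℝ × ℝ →L[ℝ] (ℝ × ℝ →L[ℝ] ℝ)} {R Z : ℝ} (hD : HasFDerivAt Du D2 (R, Z)) :
    dZZ U R Z = D2 (0, 1) (0, 1) := by
  have hfun : deriv (U R) = fun z => Du (R, z) (0, 1) := funext fun z => dZ_eq_fderiv_apply hU R z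
  have hc : HasDerivAt (fun z : ℝ => (R, z)) ((0 : ℝ), (1 : ℝ)) Z :=
    (hasDerivAt_const Z R).prodMk (hasDerivAt_id' Z)
  have hcD : HasDerivAt (fun z => Du (R, z)) (D2 (0, 1)) Z := hD.comp_hasDerivAt Z hc
  have happ : HasDerivAt (fun z => Du (R, z) (0, 1)) (D2 (0, 1) (0, 1) + Du (R, Z) 0) Z :=
    hcD.clm_apply (hasDerivAt_const Z ((0 : ℝ), (1 : ℝ)))
  unfold dZZ
  rw [show (2 : ℕ) = 1 + 1 from rfl, iteratedDeriv_succ, iteratedDeriv_one, hfun, happ.deriv, map_zero,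
    add_zero]

end chain

section outer

variable {U : ℝ → ℝ → ℝ} {Du : ℝ × ℝ → (ℝ × ℝ →L[ℝ] ℝ)} {D2 : ℝ × ℝ →L[ℝ] (ℝ × ℝ →L[ℝ] ℝ)}
  {ε κ δ₀ : ℝ}

/-- **Second derivative of `U` along the reference surface at the OUTER equatorial point:**
`(U∘γ)″(0) = (εκ)²·U_YY(1+ε,0) − ε(1+δ₀)²·U_X(1+ε,0)` (chain rule; `γ′(0) = (0, εκ)`, `γ″(0) = (−ε(1+δ₀)², 0)`).
[cite: Freidberg2014, §6.6.1 eq. (6.155)] -/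
theorem deriv2_comp_referenceSurface_outer (hU : ∀ p, HasFDerivAt (uncurry U) (Du p) p)
    (hD : HasFDerivAt Du D2 (1 + ε, 0)) :
    deriv (deriv fun τ => U (referenceSurface ε κ δ₀ τ).1 (referenceSurface ε κ δ₀ τ).2) 0
      = (ε * κ) ^ 2 * dZZ U (1 + ε) 0 - ε * (1 + δ₀) ^ 2 * dR U (1 + ε) 0 := by
  -- the curve and its first two derivatives
  set X : ℝ → ℝ := fun τ => 1 + ε * Real.cos (τ + δ₀ * Real.sin τ) with hX
  set Y : ℝ → ℝ := fun τ => ε * κ * Real.sin τ with hY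
  set X1 : ℝ → ℝ := fun τ => -(ε * Real.sin (τ + δ₀ * Real.sin τ) * (1 + δ₀ * Real.cos τ)) with hX1
  set Y1 : ℝ → ℝ := fun τ => ε * κ * Real.cos τ with hY1
  have hγ : ∀ τ, HasDerivAt (fun τ => (X τ, Y τ)) (X1 τ, Y1 τ) τ := fun τ =>
    (hasDerivAt_referenceSurface_fst ε κ δ₀ τ).prodMk (hasDerivAt_referenceSurface_snd ε κ δ₀ τ)
  -- first derivative of U ∘ γ everywhere
  have hf : ∀ τ, HasDerivAt (fun τ => U (X τ) (Y τ)) (Du (X τ, Y τ) (X1 τ, Y1 τ)) τ := fun τ => by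
    have h := (hU (X τ, Y τ)).comp_hasDerivAt τ (hγ τ)
    simp only [Function.comp_def, Function.uncurry_apply_pair] at h
    exact h
  have hderiv : deriv (fun τ => U (X τ) (Y τ)) = fun τ => Du (X τ, Y τ) (X1 τ, Y1 τ) :=
    funext fun τ => (hf τ).deriv
  -- values at τ = 0
  have hX0 : X 0 = 1 + ε := by simp [hX]
  have hY0 : Y 0 = 0 := by simp [hY]
  have hX10 : X1 0 = 0 := by simp [hX1]
  have hY10 : Y1 0 = ε * κ := by simp [hY1]
  have hD0 : HasFDerivAt Du D2 (X 0, Y 0) := by rw [hX0, hY0]; exact hD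
  -- second derivative at 0: derivative of τ ↦ Du(γ τ) (γ′ τ)
  have hc : HasDerivAt (fun τ => Du (X τ, Y τ)) (D2 (X1 0, Y1 0)) 0 := hD0.comp_hasDerivAt 0 (hγ 0)
  have hv : HasDerivAt (fun τ => (X1 τ, Y1 τ))
      (-(ε * (Real.cos (0 + δ₀ * Real.sin 0) * (1 + δ₀ * Real.cos 0) ^ 2
        - Real.sin (0 + δ₀ * Real.sin 0) * (δ₀ * Real.sin 0))), -(ε * κ * Real.sin 0)) 0 :=
    (hasDerivAt_referenceSurface_fst_deriv ε δ₀ 0).prodMk (hasDerivAt_referenceSurface_snd_deriv ε κ 0)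
  have hv0 : (-(ε * (Real.cos (0 + δ₀ * Real.sin 0) * (1 + δ₀ * Real.cos 0) ^ 2
        - Real.sin (0 + δ₀ * Real.sin 0) * (δ₀ * Real.sin 0))), -(ε * κ * Real.sin 0))
      = (-(ε * (1 + δ₀) ^ 2), (0 : ℝ)) :=
    Prod.ext (by simp only [Real.sin_zero, Real.cos_zero, mul_zero, add_zero, sub_zero, mul_one]; ring)
      (by simp only [Real.sin_zero, mul_zero, neg_zero])
  rw [hv0] at hv
  have h2 := hc.clm_apply hv
  show deriv (deriv fun τ => U (X τ) (Y τ)) 0 = _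
  rw [hderiv, h2.deriv, hX10, hY10, hX0, hY0]
  -- identify the partials
  rw [dZZ_eq_fderiv2_apply hU hD, dR_eq_fderiv_apply hU]
  have e1 : ((0 : ℝ), ε * κ) = (ε * κ) • ((0 : ℝ), (1 : ℝ)) := by ext <;> simp
  have e2 : (-(ε * (1 + δ₀) ^ 2), (0 : ℝ)) = (-(ε * (1 + δ₀) ^ 2)) • ((1 : ℝ), (0 : ℝ)) := by ext <;> simp
  rw [e1, e2, map_smul, map_smul, map_smul]
  simp only [_root_.smul_apply, smul_eq_mul]
  ring

/-- **Osculation ⇔ the GEOMETRIC curvature constraint at the outer point** (`ε, κ ≠ 0`): `(U∘γ)″(0) = 0`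
iff `U_YY(1+ε, 0) = N1·U_X(1+ε, 0)` with the typed closed form `N1 = (1+δ₀)²/(εκ²)` — constraint 2 of
`IsBoundaryFitGeom` (and NOT `U_YY = −N1·U_X` of `IsBoundaryFit`: the ERRATUM). [cite: Freidberg2014, §6.6.1 eq. (6.155)] -/
theorem deriv2_comp_referenceSurface_outer_eq_zero_iff (hU : ∀ p, HasFDerivAt (uncurry U) (Du p) p)
    (hD : HasFDerivAt Du D2 (1 + ε, 0)) (hε : ε ≠ 0) (hκ : κ ≠ 0) :
    deriv (deriv fun τ => U (referenceSurface ε κ δ₀ τ).1 (referenceSurface ε κ δ₀ τ).2) 0 = 0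
      ↔ dZZ U (1 + ε) 0 = N1 ε κ δ₀ * dR U (1 + ε) 0 := by
  rw [deriv2_comp_referenceSurface_outer hU hD]
  unfold N1
  have hne : ε * κ ^ 2 ≠ 0 := mul_ne_zero hε (pow_ne_zero 2 hκ)
  constructor
  · intro h
    have h' : ε * (ε * κ ^ 2 * dZZ U (1 + ε) 0 - (1 + δ₀) ^ 2 * dR U (1 + ε) 0) = 0 := by
      linear_combination h
    have h'' := (mul_eq_zero.mp h').resolve_left hε
    rw [div_mul_eq_mul_div, eq_div_iff hne]
    linear_combination h''
  · intro h
    rw [h]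
    field_simp
    ring

end outer

section inner

variable {U : ℝ → ℝ → ℝ} {Du : ℝ × ℝ → (ℝ × ℝ →L[ℝ] ℝ)} {D2 : ℝ × ℝ →L[ℝ] (ℝ × ℝ →L[ℝ] ℝ)}
  {ε κ δ₀ : ℝ}

/-- **Second derivative along the reference surface at the INNER equatorial point:**
`(U∘γ)″(π) = (εκ)²·U_YY(1−ε,0) + ε(1−δ₀)²·U_X(1−ε,0)` (`γ′(π) = (0, −εκ)`, `γ″(π) = (ε(1−δ₀)², 0)`).
[cite: Freidberg2014, §6.6.1 eq. (6.155)] -/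
theorem deriv2_comp_referenceSurface_inner (hU : ∀ p, HasFDerivAt (uncurry U) (Du p) p)
    (hD : HasFDerivAt Du D2 (1 - ε, 0)) :
    deriv (deriv fun τ => U (referenceSurface ε κ δ₀ τ).1 (referenceSurface ε κ δ₀ τ).2) π
      = (ε * κ) ^ 2 * dZZ U (1 - ε) 0 + ε * (1 - δ₀) ^ 2 * dR U (1 - ε) 0 := by
  set X : ℝ → ℝ := fun τ => 1 + ε * Real.cos (τ + δ₀ * Real.sin τ) with hX
  set Y : ℝ → ℝ := fun τ => ε * κ * Real.sin τ with hY
  set X1 : ℝ → ℝ := fun τ => -(ε * Real.sin (τ + δ₀ * Real.sin τ) * (1 + δ₀ * Real.cos τ)) with hX1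
  set Y1 : ℝ → ℝ := fun τ => ε * κ * Real.cos τ with hY1
  have hγ : ∀ τ, HasDerivAt (fun τ => (X τ, Y τ)) (X1 τ, Y1 τ) τ := fun τ =>
    (hasDerivAt_referenceSurface_fst ε κ δ₀ τ).prodMk (hasDerivAt_referenceSurface_snd ε κ δ₀ τ)
  have hf : ∀ τ, HasDerivAt (fun τ => U (X τ) (Y τ)) (Du (X τ, Y τ) (X1 τ, Y1 τ)) τ := fun τ => by
    have h := (hU (X τ, Y τ)).comp_hasDerivAt τ (hγ τ)
    simp only [Function.comp_def, Function.uncurry_apply_pair] at h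
    exact h
  have hderiv : deriv (fun τ => U (X τ) (Y τ)) = fun τ => Du (X τ, Y τ) (X1 τ, Y1 τ) :=
    funext fun τ => (hf τ).deriv
  have hXπ : X π = 1 - ε := by simp [hX]; ring
  have hYπ : Y π = 0 := by simp [hY]
  have hX1π : X1 π = 0 := by simp [hX1]
  have hY1π : Y1 π = -(ε * κ) := by simp [hY1]
  have hDπ : HasFDerivAt Du D2 (X π, Y π) := by rw [hXπ, hYπ]; exact hD
  have hc : HasDerivAt (fun τ => Du (X τ, Y τ)) (D2 (X1 π, Y1 π)) π := hDπ.comp_hasDerivAt π (hγ π)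
  have hv : HasDerivAt (fun τ => (X1 τ, Y1 τ))
      (-(ε * (Real.cos (π + δ₀ * Real.sin π) * (1 + δ₀ * Real.cos π) ^ 2
        - Real.sin (π + δ₀ * Real.sin π) * (δ₀ * Real.sin π))), -(ε * κ * Real.sin π)) π :=
    (hasDerivAt_referenceSurface_fst_deriv ε δ₀ π).prodMk (hasDerivAt_referenceSurface_snd_deriv ε κ π)
  have hv0 : (-(ε * (Real.cos (π + δ₀ * Real.sin π) * (1 + δ₀ * Real.cos π) ^ 2
        - Real.sin (π + δ₀ * Real.sin π) * (δ₀ * Real.sin π))), -(ε * κ * Real.sin π))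
      = (ε * (1 - δ₀) ^ 2, (0 : ℝ)) :=
    Prod.ext (by simp only [Real.sin_pi, Real.cos_pi, mul_zero, add_zero, sub_zero, mul_neg, mul_one]; ring)
      (by simp only [Real.sin_pi, mul_zero, neg_zero])
  rw [hv0] at hv
  have h2 := hc.clm_apply hv
  show deriv (deriv fun τ => U (X τ) (Y τ)) π = _
  rw [hderiv, h2.deriv, hX1π, hY1π, hXπ, hYπ]
  rw [dZZ_eq_fderiv2_apply hU hD, dR_eq_fderiv_apply hU]
  have e1 : ((0 : ℝ), -(ε * κ)) = (-(ε * κ)) • ((0 : ℝ), (1 : ℝ)) := by ext <;> simp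
  have e2 : (ε * (1 - δ₀) ^ 2, (0 : ℝ)) = (ε * (1 - δ₀) ^ 2) • ((1 : ℝ), (0 : ℝ)) := by ext <;> simp
  rw [e1, e2, map_smul, map_smul, map_smul]
  simp only [_root_.smul_apply, smul_eq_mul]
  ring

/-- **Osculation ⇔ the GEOMETRIC curvature constraint at the inner point** (`ε, κ ≠ 0`): `(U∘γ)″(π) = 0`
iff `U_YY(1−ε, 0) = N2·U_X(1−ε, 0)` with the typed closed form `N2 = −(1−δ₀)²/(εκ²)` — constraint 4 of
`IsBoundaryFitGeom`. [cite: Freidberg2014, §6.6.1 eq. (6.155)] -/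
theorem deriv2_comp_referenceSurface_inner_eq_zero_iff (hU : ∀ p, HasFDerivAt (uncurry U) (Du p) p)
    (hD : HasFDerivAt Du D2 (1 - ε, 0)) (hε : ε ≠ 0) (hκ : κ ≠ 0) :
    deriv (deriv fun τ => U (referenceSurface ε κ δ₀ τ).1 (referenceSurface ε κ δ₀ τ).2) π = 0
      ↔ dZZ U (1 - ε) 0 = N2 ε κ δ₀ * dR U (1 - ε) 0 := by
  rw [deriv2_comp_referenceSurface_inner hU hD]
  unfold N2
  have hne : ε * κ ^ 2 ≠ 0 := mul_ne_zero hε (pow_ne_zero 2 hκ)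
  constructor
  · intro h
    have h' : ε * (ε * κ ^ 2 * dZZ U (1 - ε) 0 + (1 - δ₀) ^ 2 * dR U (1 - ε) 0) = 0 := by
      linear_combination h
    have h'' := (mul_eq_zero.mp h').resolve_left hε
    have key : dZZ U (1 - ε) 0 = -((1 - δ₀) ^ 2 * dR U (1 - ε) 0) / (ε * κ ^ 2) := by
      rw [eq_div_iff hne]
      linear_combination h''
    rw [key]
    ring
  · intro h
    rw [h]
    field_simp
    ring

end inner

end Literature.MathematicalPhysics.MHD.CerfonFreidberg
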